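import Literature.AlgebraicGeometry.AbelianSchemes.PELTupleSpreadMove                              -- ★ (mine) the MOVE: `tupleRel_id_comp_facObjIso_inv_of_compat`, restriction §3
import Literature.AlgebraicGeometry.AbelianSchemes.AbelianSchemeOverSpreadStageOfProperGenericFibre -- ★ (s1-A♭) `exists_stage_of_generic_of_isOfRelDim_of_isProper_generic`
import Literature.AlgebraicGeometry.AbelianSchemes.TupleTransportToBaseChange                       -- ★ transport package `exists_transport_baseChange_tupleRel_id_of_isBaseChangeVia`
import Literature.AlgebraicGeometry.AbelianSchemes.PolarizationSpreadOfGenericPolarization          -- ★ (s2-λ) `exists_stage_polarization_of_generic_polarization_of_isUnit_two'`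
import Literature.AlgebraicGeometry.AbelianSchemes.AbelianSchemeOverSpreadStageStructure            -- ★ (s1-ι) `exists_stage_ringAction`
import Literature.AlgebraicGeometry.AbelianSchemes.LevelStructureSpreadRelative                     -- ★ (s3) `LevelStructure.exists_stage_of_generic_overStage`
import Literature.AlgebraicGeometry.AbelianSchemes.LevelStructureSpreadStages                       -- ★ `exists_idx_forall_isUnit_algebraMap_loc`
import Literature.AlgebraicGeometry.AbelianSchemes.DualAbelianSchemeExistsLetter                    -- ★ `dualAbelianSchemeExists`, `dualPairOf`
import Literature.AlgebraicGeometry.AbelianSchemes.AbelianSchemeDualPairNormalize                   -- ★ `DualPair.normalize`, `nonempty_unitHatSlice_iso_normalize`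
import Literature.AlgebraicGeometry.AbelianSchemes.RingActionTransportAlongIso                      -- ★ GS-1a `RingAction.exists_transport_of_iso_symm`
import Literature.AlgebraicGeometry.AbelianSchemes.LevelStructureTransportIso                       -- ★ `LevelStructure.exists_comp_of_iso`
import Literature.AlgebraicGeometry.AbelianSchemes.AbelianSchemeOverHomNoetherianAnyBase            -- ★ `isCommMonObj_of_isLocallyNoetherian_base`
import Literature.AlgebraicGeometry.AbelianSchemes.TupleRelBaseChangeUnique                         -- ★ canonical relation `tupleRel_baseChange_fst`
import Literature.AlgebraicGeometry.AbelianSchemes.TupleRelActionDescent                            -- ★ (mine) `tupleRel_congr_base`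
import HarnessLib

/-!
# GSPREAD-CORE: a PEL tuple over the generic base `P ⊗_A K` is the base change of a PEL tuple over a stage `P ⊗_A A[1∕s]`

Road (S♭) of `stub_GSPREAD` (crux hLiu418, [Liu2024] Prop. 4.18 via the integral PEL reading): `A` a Noetherian domain with fraction
field `K` (`char K = 0`), `P → Spec A` separated, quasi-compact, locally of finite presentation with PROPER, reduced generic fibre
`P ⊗_A K`; `(A₁, ι₁, (Â₁, 𝒫₁), λ₁, φ₁)` an `𝒪`-PEL tuple over `P ⊗_A K` (abelian scheme of relative dimension `g`, `𝒪`-action, dual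
pair, polarisation, level-`N` structure, `N ∈ K^×`).  THEN there are `s ∈ A ∖ 0`, a PEL tuple `(𝒜, ι, (Â, 𝒫), λ, φ)` over the stage
`P ⊗_A A[1∕s]` (relative dimension `g`, stage flat over `P`) and maps `(G, Ĝ)` exhibiting the generic tuple as its base change along
`P ⊗ Spec K → P ⊗ D(s)` — ALL SIX CLAUSES of ★ `tupleRel_trans` ([MumfordFogartyKirwan1994] Def. 7.2: «`𝒜(f)(X, λ, σᵢ)`», with the
`𝒪`-clause of [Kottwitz1992] §5).

Assembly ([EGAIV3] 8.8.2 ∕ 8.10.5, [MumfordFogartyKirwan1994] Ch. 7 §2–3, organ by organ): (1) ★ (s1-A♭) spreads `A₁` to `𝒜₀` over a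
stage `t₀`; (2) restrict to `t ≤ t₀` with `2 ∈ A[1∕t]^×` (★ `exists_idx_forall_isUnit_algebraMap_loc`, MOVE §3); (3) choose the
normalised dual pair `Dₜ` (★ `dualPairOf`, ★ `normalize`) and TRANSPORT `(ι₁, λ₁, φ₁)` to `𝒜ₜ ×_{P_t} (P ⊗ Spec K)` — an isomorphism of
tuples (★ `exists_transport_baseChange_tupleRel_id_of_isBaseChangeVia`); (4) ★ (s2-λ) spreads `λ` to a ★ `Polarization` two stages
down, (5) ★ (s1-ι) spreads the `𝒪`-action, (6) ★ (s3) spreads the level structure — after each organ the generic tuple is MOVED to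
the finer stage by ★ `tupleRel_id_comp_facObjIso_inv_of_compat` (structures already spread move by ★ `facObjIso_hom_naturality`,
the others are transported: ★ `LevelStructure.exists_comp_of_iso`, ★ GS-1a); (7) at the last stage every generic structure IS the
base change of a stage structure, and the canonical relation ★ `tupleRel_baseChange_fst` composed with the accumulated isomorphism
of tuples (★ `tupleRel_trans`, `𝟙 ≫ f = f`) is the claim.

## What existed / was missing / was proved
* existed (★): the organs and glue named above.
* missing, proved here (sorry-free): the move-with-transport steps `exists_levelStructure_tupleRel_id_comp_facObjIso_inv`,
  `exists_ringAction_levelStructure_tupleRel_id_comp_facObjIso_inv`, the second half `exists_stage_pelTuple_of_stage_polarization`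
  (from a stage family with a stage polarisation) and the head `exists_stage_pelTuple_of_generic`.
-/

set_option autoImplicit false

noncomputable section

-- Mathlib's `Over`/pull-back API is stated across semireducible wrappers (as in the ★ `AbelianSchemes/*` files).
set_option backward.isDefEq.respectTransparency false

open CategoryTheory CategoryTheory.Limits AlgebraicGeometry MonoidalCategory
open Literature.AlgebraicGeometry.Limits Literature.AlgebraicGeometry.Limits.LocApprox
open Literature.AlgebraicGeometry.Limits.OverFac (facObjIso)
open Literature.AlgebraicGeometry.Motives (SchemeOver specOver)

namespace Literature.AlgebraicGeometry.AbelianSchemes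

namespace AbelianSchemeOver

/-! ### §1 Moves with transport of the structures not yet spread -/

section Move

universe u

variable {X : Scheme.{u}} {T G : Over X} (ℓ : G ⟶ T) (𝒜 : AbelianSchemeOver X) (D : 𝒜.DualPair) {O : Type*} [CommRing O] {g n : ℕ}
  {A₁ : AbelianSchemeOver G.left} (act₁ : O → (A₁.X ⟶ A₁.X)) (D₁ : A₁.DualPair) (lam₁ : A₁.X ⟶ D₁.hat.X) (φ₁ : A₁.LevelStructure g n)
  (act : O → ((𝒜.baseChange G.hom).X ⟶ (𝒜.baseChange G.hom).X)) (lam : (𝒜.baseChange G.hom).X ⟶ (D.baseChange G.hom).hat.X)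
  (φ : (𝒜.baseChange G.hom).LevelStructure g n)
  {M : A₁.X.left ⟶ (𝒜.baseChange G.hom).X.left} {Mh : D₁.hat.X.left ⟶ (D.baseChange G.hom).hat.X.left}

omit [CommRing O] in
/-- **MOVE, TRANSPORTING THE LEVEL STRUCTURE.**  As ★ `tupleRel_id_comp_facObjIso_inv_of_compat`, with the level structure on the finer family
PRODUCED by transport along `facObjIso⁻¹` (★ `LevelStructure.exists_comp_of_iso`, ★ `isMonHom_facObjIso_inv`) instead of given.
[cite: MumfordFogartyKirwan1994, Ch. 7 §2 Definitions 7.1–7.3 (pp. 129–130)] [cite: GortzWedhorn2020, Section (4.7) (pp. 107–108)] -/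
theorem exists_levelStructure_tupleRel_id_comp_facObjIso_inv
    (h : φ₁.IsBaseChangeVia φ (𝟙 G.left) M ∧ D₁.hat.IsBaseChangeVia (D.baseChange G.hom).hat (𝟙 G.left) Mh ∧
      (∃ (wG : A₁.X.hom ≫ 𝟙 G.left = M ≫ (𝒜.baseChange G.hom).X.hom) (wĜ : D₁.hat.X.hom ≫ 𝟙 G.left = Mh ≫ (D.baseChange G.hom).hat.X.hom),
        Nonempty ((Scheme.Modules.pullback
          (pullback.map A₁.X.hom D₁.hat.X.hom (𝒜.baseChange G.hom).X.hom (D.baseChange G.hom).hat.X.hom M Mh (𝟙 G.left) wG wĜ)).obj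
            (D.baseChange G.hom).P ≅ D₁.P)) ∧
      lam₁.left ≫ Mh = M ≫ lam.left ∧ ∀ a : O, (act₁ a).left ≫ M = M ≫ (act a).left)
    (act' : O → (((𝒜.baseChange T.hom).baseChange ℓ.left).X ⟶ ((𝒜.baseChange T.hom).baseChange ℓ.left).X))
    (lam' : ((𝒜.baseChange T.hom).baseChange ℓ.left).X ⟶ ((D.baseChange T.hom).baseChange ℓ.left).hat.X)
    (hlam : lam' ≫ (facObjIso ℓ D.hat.X).hom = (facObjIso ℓ 𝒜.X).hom ≫ lam)
    (hact : ∀ a, act' a ≫ (facObjIso ℓ 𝒜.X).hom = (facObjIso ℓ 𝒜.X).hom ≫ act a) :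
    ∃ φ' : ((𝒜.baseChange T.hom).baseChange ℓ.left).LevelStructure g n,
      φ₁.IsBaseChangeVia φ' (𝟙 G.left) (M ≫ (facObjIso ℓ 𝒜.X).inv.left) ∧
      D₁.hat.IsBaseChangeVia ((D.baseChange T.hom).baseChange ℓ.left).hat (𝟙 G.left) (Mh ≫ (facObjIso ℓ D.hat.X).inv.left) ∧
      (∃ (wG : A₁.X.hom ≫ 𝟙 G.left = (M ≫ (facObjIso ℓ 𝒜.X).inv.left) ≫ ((𝒜.baseChange T.hom).baseChange ℓ.left).X.hom)
          (wĜ : D₁.hat.X.hom ≫ 𝟙 G.left = (Mh ≫ (facObjIso ℓ D.hat.X).inv.left) ≫ ((D.baseChange T.hom).baseChange ℓ.left).hat.X.hom),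
        Nonempty ((Scheme.Modules.pullback
          (pullback.map A₁.X.hom D₁.hat.X.hom ((𝒜.baseChange T.hom).baseChange ℓ.left).X.hom
            ((D.baseChange T.hom).baseChange ℓ.left).hat.X.hom (M ≫ (facObjIso ℓ 𝒜.X).inv.left) (Mh ≫ (facObjIso ℓ D.hat.X).inv.left)
            (𝟙 G.left) wG wĜ)).obj ((D.baseChange T.hom).baseChange ℓ.left).P ≅ D₁.P)) ∧
      lam₁.left ≫ (Mh ≫ (facObjIso ℓ D.hat.X).inv.left) = (M ≫ (facObjIso ℓ 𝒜.X).inv.left) ≫ lam'.left ∧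
      ∀ a : O, (act₁ a).left ≫ (M ≫ (facObjIso ℓ 𝒜.X).inv.left) = (M ≫ (facObjIso ℓ 𝒜.X).inv.left) ≫ (act' a).left := by
  haveI : IsMonHom (M := (𝒜.baseChange G.hom).X) (N := ((𝒜.baseChange T.hom).baseChange ℓ.left).X) (facObjIso ℓ 𝒜.X).inv :=
    isMonHom_facObjIso_inv ℓ 𝒜.X
  haveI : IsMonHom (M := (𝒜.baseChange G.hom).X) (N := ((𝒜.baseChange T.hom).baseChange ℓ.left).X) (facObjIso ℓ 𝒜.X).symm.hom :=
    (inferInstance : IsMonHom (M := (𝒜.baseChange G.hom).X) (N := ((𝒜.baseChange T.hom).baseChange ℓ.left).X) (facObjIso ℓ 𝒜.X).inv)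
  obtain ⟨φ', hφ'⟩ := LevelStructure.exists_comp_of_iso (A₁ := (𝒜.baseChange T.hom).baseChange ℓ.left) (A₂ := 𝒜.baseChange G.hom)
    (facObjIso ℓ 𝒜.X).symm φ
  have hσ : ∀ i, φ'.σ i ≫ (facObjIso ℓ 𝒜.X).hom = φ.σ i := fun i => by
    rw [hφ' i, Iso.symm_hom, Category.assoc, Iso.inv_hom_id, Category.comp_id]
  exact ⟨φ', tupleRel_id_comp_facObjIso_inv_of_compat ℓ 𝒜 D act₁ D₁ lam₁ φ₁ act lam φ h act' lam' φ' hσ hlam hact⟩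

/-- **MOVE, TRANSPORTING THE LEVEL STRUCTURE AND THE `𝒪`-ACTION** (★ GS-1a `RingAction.exists_transport_of_iso_symm` through `facObjIso`, then §1).
[cite: MumfordFogartyKirwan1994, Ch. 7 §2 Definitions 7.1–7.3 (pp. 129–130)] [cite: Kottwitz1992, §5 (p. 390)] -/
theorem exists_ringAction_levelStructure_tupleRel_id_comp_facObjIso_inv (ρ : RingAction O (𝒜.baseChange G.hom))
    (h : φ₁.IsBaseChangeVia φ (𝟙 G.left) M ∧ D₁.hat.IsBaseChangeVia (D.baseChange G.hom).hat (𝟙 G.left) Mh ∧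
      (∃ (wG : A₁.X.hom ≫ 𝟙 G.left = M ≫ (𝒜.baseChange G.hom).X.hom) (wĜ : D₁.hat.X.hom ≫ 𝟙 G.left = Mh ≫ (D.baseChange G.hom).hat.X.hom),
        Nonempty ((Scheme.Modules.pullback
          (pullback.map A₁.X.hom D₁.hat.X.hom (𝒜.baseChange G.hom).X.hom (D.baseChange G.hom).hat.X.hom M Mh (𝟙 G.left) wG wĜ)).obj
            (D.baseChange G.hom).P ≅ D₁.P)) ∧
      lam₁.left ≫ Mh = M ≫ lam.left ∧ ∀ a : O, (act₁ a).left ≫ M = M ≫ (ρ.i a).left)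
    (lam' : ((𝒜.baseChange T.hom).baseChange ℓ.left).X ⟶ ((D.baseChange T.hom).baseChange ℓ.left).hat.X)
    (hlam : lam' ≫ (facObjIso ℓ D.hat.X).hom = (facObjIso ℓ 𝒜.X).hom ≫ lam) :
    ∃ (ρ' : RingAction O ((𝒜.baseChange T.hom).baseChange ℓ.left)) (φ' : ((𝒜.baseChange T.hom).baseChange ℓ.left).LevelStructure g n),
      φ₁.IsBaseChangeVia φ' (𝟙 G.left) (M ≫ (facObjIso ℓ 𝒜.X).inv.left) ∧
      D₁.hat.IsBaseChangeVia ((D.baseChange T.hom).baseChange ℓ.left).hat (𝟙 G.left) (Mh ≫ (facObjIso ℓ D.hat.X).inv.left) ∧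
      (∃ (wG : A₁.X.hom ≫ 𝟙 G.left = (M ≫ (facObjIso ℓ 𝒜.X).inv.left) ≫ ((𝒜.baseChange T.hom).baseChange ℓ.left).X.hom)
          (wĜ : D₁.hat.X.hom ≫ 𝟙 G.left = (Mh ≫ (facObjIso ℓ D.hat.X).inv.left) ≫ ((D.baseChange T.hom).baseChange ℓ.left).hat.X.hom),
        Nonempty ((Scheme.Modules.pullback
          (pullback.map A₁.X.hom D₁.hat.X.hom ((𝒜.baseChange T.hom).baseChange ℓ.left).X.hom
            ((D.baseChange T.hom).baseChange ℓ.left).hat.X.hom (M ≫ (facObjIso ℓ 𝒜.X).inv.left) (Mh ≫ (facObjIso ℓ D.hat.X).inv.left)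
            (𝟙 G.left) wG wĜ)).obj ((D.baseChange T.hom).baseChange ℓ.left).P ≅ D₁.P)) ∧
      lam₁.left ≫ (Mh ≫ (facObjIso ℓ D.hat.X).inv.left) = (M ≫ (facObjIso ℓ 𝒜.X).inv.left) ≫ lam'.left ∧
      ∀ a : O, (act₁ a).left ≫ (M ≫ (facObjIso ℓ 𝒜.X).inv.left) = (M ≫ (facObjIso ℓ 𝒜.X).inv.left) ≫ (ρ'.i a).left := by
  haveI : IsMonHom (M := ((𝒜.baseChange T.hom).baseChange ℓ.left).X) (N := (𝒜.baseChange G.hom).X) (facObjIso ℓ 𝒜.X).hom :=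
    isMonHom_facObjIso_hom ℓ 𝒜.X
  obtain ⟨ρ', hρ'⟩ := RingAction.exists_transport_of_iso_symm (A := 𝒜.baseChange G.hom) (A' := (𝒜.baseChange T.hom).baseChange ℓ.left)
    ρ (facObjIso ℓ 𝒜.X)
  have hact : ∀ a, ρ'.i a ≫ (facObjIso ℓ 𝒜.X).hom = (facObjIso ℓ 𝒜.X).hom ≫ ρ.i a := fun a => by
    rw [hρ' a, Category.assoc, Category.assoc, Iso.inv_hom_id, Category.comp_id]
  obtain ⟨φ', h'⟩ := exists_levelStructure_tupleRel_id_comp_facObjIso_inv ℓ 𝒜 D act₁ D₁ lam₁ φ₁ (fun a => ρ.i a) lam φ h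
    (fun a => ρ'.i a) lam' hlam hact
  exact ⟨ρ', φ', h'⟩

end Move

/-! ### §2 The head: spread of a generic PEL tuple to a stage -/

section Head

variable {A : Type} [CommRing A] [IsDomain A] [IsNoetherianRing A] (K : Type) [Field K] [CharZero K] [Algebra A K] [IsFractionRing A K]
  {P : SchemeOver A} [QuasiCompact P.hom] [QuasiSeparated P.hom] [LocallyOfFinitePresentation P.hom] [IsSeparated P.hom]
  [∀ s : Idx (nonZeroDivisors A), IsLocallyNoetherian (P ⊗ (baseDiagram (nonZeroDivisors A)).obj s).left]
  [IsLocallyNoetherian (P ⊗ specOver A K).left] [IsReduced (P ⊗ specOver A K).left]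

omit [CharZero K] [IsSeparated P.hom] [IsNoetherianRing A] [IsLocallyNoetherian (P ⊗ specOver A K).left]
  [IsReduced (P ⊗ specOver A K).left] in
/-- **GSPREAD-CORE, SECOND HALF: from a stage family WITH a stage polarisation.**  `𝒜ₛ` over `P ⊗ D(s)` (relative dimension `g`, stage flat) with a
dual pair `Dₛ` and a ★ `Polarization` `polₛ`; on the generic base change `𝒜ₛ ×_{P_s} (P ⊗ Spec K)` an `𝒪`-action `ρ` and a level-`N` structure `φ`
(`N ∈ K^×`); a tuple `(A₁, ι₁, (Â₁, 𝒫₁), λ₁, φ₁)` over `P ⊗ Spec K` related to `(𝒜ₛ ×_{P_s} (P ⊗ Spec K), ρ, Dₛ × …, (λₛ)_K, φ)` by the six clauses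
along `𝟙`.  THEN the conclusion of `exists_stage_pelTuple_of_generic` holds: ★ (s1-ι) spreads `ρ` (MOVE transporting `φ`), ★ (s3) spreads the level
structure (MOVE by ★ `levelSection_comp_facObjIso_inv_eq_baseChange` and ★ `facObjIso_hom_naturality`), then ★ `tupleRel_baseChange_fst` + ★ `tupleRel_trans`.
[cite: MumfordFogartyKirwan1994, Ch. 7 §2 Definition 7.2 (p. 129) and §3 Proposition 7.3 step (IV) (pp. 133–134)] [cite: EGAIV3, Thm. 8.8.2 (i)]
[cite: Kottwitz1992, §5 (pp. 389–391)] [cite: GortzWedhorn2020, §(10.13) and Cor. 10.64 (pp. 261–267)] -/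
theorem exists_stage_pelTuple_of_stage_polarization {O : Type*} [CommRing O] {m : ℕ} (bs : Module.Basis (Fin m) ℤ O) {g N : ℕ} [NeZero N]
    (hN : IsUnit ((N : ℕ) : K)) {s : Idx (nonZeroDivisors A)} [Flat (pullback.snd P.hom ((baseDiagram (nonZeroDivisors A)).obj s).hom)]
    (𝒜ₛ : AbelianSchemeOver (P ⊗ (baseDiagram (nonZeroDivisors A)).obj s).left) (hgs : 𝒜ₛ.IsOfRelDim g) (Dₛ : 𝒜ₛ.DualPair)
    (polS : 𝒜ₛ.Polarization Dₛ) (ρg : RingAction O (𝒜ₛ.baseChange (genOver (nonZeroDivisors A) K P s).hom))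
    (φg : LevelStructure g N (𝒜ₛ.baseChange (genOver (nonZeroDivisors A) K P s).hom))
    (A₁ : AbelianSchemeOver (P ⊗ specOver A K).left) (ρ₁ : RingAction O A₁) (D₁ : A₁.DualPair) (pol₁ : A₁.Polarization D₁)
    (φ₁ : A₁.LevelStructure g N) {M : A₁.X.left ⟶ (𝒜ₛ.baseChange (genOver (nonZeroDivisors A) K P s).hom).X.left}
    {Mh : D₁.hat.X.left ⟶ (Dₛ.baseChange (genOver (nonZeroDivisors A) K P s).hom).hat.X.left}
    (h : φ₁.IsBaseChangeVia φg (𝟙 _) M ∧ D₁.hat.IsBaseChangeVia (Dₛ.baseChange (genOver (nonZeroDivisors A) K P s).hom).hat (𝟙 _) Mh ∧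
      (∃ (wG : A₁.X.hom ≫ 𝟙 _ = M ≫ (𝒜ₛ.baseChange (genOver (nonZeroDivisors A) K P s).hom).X.hom)
          (wĜ : D₁.hat.X.hom ≫ 𝟙 _ = Mh ≫ (Dₛ.baseChange (genOver (nonZeroDivisors A) K P s).hom).hat.X.hom),
        Nonempty ((Scheme.Modules.pullback
          (pullback.map A₁.X.hom D₁.hat.X.hom (𝒜ₛ.baseChange (genOver (nonZeroDivisors A) K P s).hom).X.hom
            (Dₛ.baseChange (genOver (nonZeroDivisors A) K P s).hom).hat.X.hom M Mh (𝟙 _) wG wĜ)).obj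
            (Dₛ.baseChange (genOver (nonZeroDivisors A) K P s).hom).P ≅ D₁.P)) ∧
      pol₁.lam.left ≫ Mh = M ≫ ((Over.pullback (genOver (nonZeroDivisors A) K P s).hom).map polS.lam).left ∧
      ∀ a : O, (ρ₁.i a).left ≫ M = M ≫ (ρg.i a).left) :
    ∃ (s : Idx (nonZeroDivisors A)) (𝒜 : AbelianSchemeOver (P ⊗ (baseDiagram (nonZeroDivisors A)).obj s).left) (ρ : RingAction O 𝒜)
      (D : 𝒜.DualPair) (pol : 𝒜.Polarization D) (φ : 𝒜.LevelStructure g N) (G : A₁.X.left ⟶ 𝒜.X.left) (Ĝ : D₁.hat.X.left ⟶ D.hat.X.left),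
      𝒜.IsOfRelDim g ∧ Flat (pullback.snd P.hom ((baseDiagram (nonZeroDivisors A)).obj s).hom) ∧
      (φ₁.IsBaseChangeVia φ (P ◁ (baseCone (nonZeroDivisors A) K).π.app s).left G ∧
        D₁.hat.IsBaseChangeVia D.hat (P ◁ (baseCone (nonZeroDivisors A) K).π.app s).left Ĝ ∧
        (∃ (wG : A₁.X.hom ≫ (P ◁ (baseCone (nonZeroDivisors A) K).π.app s).left = G ≫ 𝒜.X.hom)
            (wĜ : D₁.hat.X.hom ≫ (P ◁ (baseCone (nonZeroDivisors A) K).π.app s).left = Ĝ ≫ D.hat.X.hom),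
          Nonempty ((Scheme.Modules.pullback
            (pullback.map A₁.X.hom D₁.hat.X.hom 𝒜.X.hom D.hat.X.hom G Ĝ (P ◁ (baseCone (nonZeroDivisors A) K).π.app s).left wG wĜ)).obj
              D.P ≅ D₁.P)) ∧
        pol₁.lam.left ≫ Ĝ = G ≫ pol.lam.left ∧ ∀ a : O, (ρ₁.i a).left ≫ G = G ≫ (ρ.i a).left) := by
  haveI : IsLocallyNoetherian (P ⊗ (baseDiagram (nonZeroDivisors A)).obj s).left := inferInstance
  -- (5) ★ (s1-ι) at the stage `s`: spread the `𝒪`-action (commutative law and flatness of the stage from the locally Noetherian base)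
  haveI : IsCommMonObj 𝒜ₛ.X :=
    isCommMonObj_of_isLocallyNoetherian_base _
  obtain ⟨s₂, σ₂, ρS, hz⟩ := exists_stage_ringAction K
    𝒜ₛ bs ρg
  -- MOVE 3 along `σ₂` (the action is now a base change; the level structure is transported once more)
  have hlam₃ := facObjIso_hom_naturality (relLeg (nonZeroDivisors A) K P σ₂)
    𝒜ₛ
    (ℬ := Dₛ.hat) polS.lam
  obtain ⟨φg₃, hR₃⟩ := exists_levelStructure_tupleRel_id_comp_facObjIso_inv (relLeg (nonZeroDivisors A) K P σ₂)
    𝒜ₛ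
    Dₛ
    (fun a => ρ₁.i a) D₁ pol₁.lam φ₁ (fun a => ρg.i a) _ φg h
    (fun a => (Over.pullback (relLeg (nonZeroDivisors A) K P σ₂).left).map (ρS.i a))
    ((Over.pullback (relLeg (nonZeroDivisors A) K P σ₂).left).map
      ((Over.pullback (stageOver (nonZeroDivisors A) P σ₂).hom).map polS.lam)) hlam₃ hz
  clear h hlam₃ hz
  -- (6) ★ (s3) at the stage `s₂`: spread the level structure
  have hg₂ : (𝒜ₛ.baseChange
      (stageOver (nonZeroDivisors A) P σ₂).hom).IsOfRelDim g := hgs.baseChange _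
  obtain ⟨s₃, σ₃, ψ, M, hM, hψ⟩ := LevelStructure.exists_stage_of_generic_overStage K
    (𝒜ₛ.baseChange
      (stageOver (nonZeroDivisors A) P σ₂).hom) hg₂ hN φg₃
  -- MOVE 4 along `σ₃` (all structures are base changes now)
  have hσ₄ : ∀ i, (ψ.baseChange (relLeg (nonZeroDivisors A) K P σ₃).left).σ i ≫
      (facObjIso (relLeg (nonZeroDivisors A) K P σ₃) (𝒜ₛ.baseChange (stageOver (nonZeroDivisors A) P σ₂).hom).X).hom = φg₃.σ i := fun i => by
    rw [← levelSection_comp_facObjIso_inv_eq_baseChange (relLeg (nonZeroDivisors A) K P σ₃) _ φg₃ ψ hψ hM i, Category.assoc,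
      Iso.inv_hom_id, Category.comp_id]
  have hlam₄ := facObjIso_hom_naturality (relLeg (nonZeroDivisors A) K P σ₃)
    (𝒜ₛ.baseChange
      (stageOver (nonZeroDivisors A) P σ₂).hom)
    (ℬ := (Dₛ.baseChange
      (stageOver (nonZeroDivisors A) P σ₂).hom).hat)
    (polS.baseChange (stageOver (nonZeroDivisors A) P σ₂).hom).lam
  have hact₄ : ∀ a : O, (Over.pullback (relLeg (nonZeroDivisors A) K P σ₃).left).map
      ((Over.pullback (stageOver (nonZeroDivisors A) P σ₃).hom).map (ρS.i a)) ≫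
      (facObjIso (relLeg (nonZeroDivisors A) K P σ₃) (𝒜ₛ.baseChange (stageOver (nonZeroDivisors A) P σ₂).hom).X).hom =
      (facObjIso (relLeg (nonZeroDivisors A) K P σ₃) (𝒜ₛ.baseChange (stageOver (nonZeroDivisors A) P σ₂).hom).X).hom ≫
      (Over.pullback (genOver (nonZeroDivisors A) K P s₂).hom).map (ρS.i a) := fun a =>
    facObjIso_hom_naturality (relLeg (nonZeroDivisors A) K P σ₃)
      (𝒜ₛ.baseChange
        (stageOver (nonZeroDivisors A) P σ₂).hom)
      (ℬ := 𝒜ₛ.baseChange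
        (stageOver (nonZeroDivisors A) P σ₂).hom) (ρS.i a)
  have hR₄ := tupleRel_id_comp_facObjIso_inv_of_compat (relLeg (nonZeroDivisors A) K P σ₃)
    (𝒜ₛ.baseChange
      (stageOver (nonZeroDivisors A) P σ₂).hom)
    (Dₛ.baseChange
      (stageOver (nonZeroDivisors A) P σ₂).hom)
    (fun a => ρ₁.i a) D₁ pol₁.lam φ₁ _ _ φg₃ hR₃
    (fun a => (Over.pullback (relLeg (nonZeroDivisors A) K P σ₃).left).map
      ((Over.pullback (stageOver (nonZeroDivisors A) P σ₃).hom).map (ρS.i a)))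
    _ (ψ.baseChange (relLeg (nonZeroDivisors A) K P σ₃).left) hσ₄ hlam₄ hact₄
  clear hR₃ hσ₄ hlam₄ hact₄
  -- (7) the last stage: every generic structure is the base change of a stage structure; canonical relation + accumulated isomorphism
  have hcan := tupleRel_baseChange_fst
    ((𝒜ₛ.baseChange
      (stageOver (nonZeroDivisors A) P σ₂).hom).baseChange (stageOver (nonZeroDivisors A) P σ₃).hom)
    (ρS.baseChange (stageOver (nonZeroDivisors A) P σ₃).hom)
    ((Dₛ.baseChange
      (stageOver (nonZeroDivisors A) P σ₂).hom).baseChange (stageOver (nonZeroDivisors A) P σ₃).hom)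
    ((polS.baseChange (stageOver (nonZeroDivisors A) P σ₂).hom).baseChange (stageOver (nonZeroDivisors A) P σ₃).hom) ψ
    (genOver (nonZeroDivisors A) K P s₃).hom
  have hfin := tupleRel_congr_base (Category.id_comp _) (tupleRel_trans hR₄ hcan)
  haveI hfl₃ : Flat (pullback.snd P.hom ((baseDiagram (nonZeroDivisors A)).obj s₃).hom) :=
    flat_snd_baseDiagram_of_hom σ₃ (flat_snd_baseDiagram_of_hom σ₂ ‹_›)
  exact ⟨s₃, _, ρS.baseChange (stageOver (nonZeroDivisors A) P σ₃).hom, _,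
    (polS.baseChange (stageOver (nonZeroDivisors A) P σ₂).hom).baseChange (stageOver (nonZeroDivisors A) P σ₃).hom, ψ, _, _,
    hg₂.baseChange _, hfl₃, hfin⟩


/-- **GSPREAD-CORE — A PEL TUPLE OVER THE GENERIC BASE IS THE BASE CHANGE OF A PEL TUPLE OVER A STAGE.**  `A` a Noetherian domain, `K = Frac A` of
characteristic `0`, `P → Spec A` separated, quasi-compact, locally of finite presentation, with proper generic fibre and `P ⊗_A K` reduced (the stages
`P ⊗ D(s)` locally Noetherian); `N ∈ K^×`, `𝒪` an order with a `ℤ`-basis.  For an `𝒪`-PEL tuple `(A₁, ι₁, (Â₁, 𝒫₁), λ₁, φ₁)` over `P ⊗_A K` of relative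
dimension `g` there are a stage `s`, an `𝒪`-PEL tuple `(𝒜, ι, (Â, 𝒫), λ, φ)` over `P ⊗ D(s)` of relative dimension `g` with `P ⊗ D(s) → P` flat, and
`(G, Ĝ)` satisfying the SIX CLAUSES along the cone leg `P ⊗ Spec K → P ⊗ D(s)`: level ∕ `X`, `X̂`, Poincaré, `λ`, `𝒪`.  Organs: ★ (s1-A♭), ★ transport
package, ★ (s2-λ), ★ (s1-ι), ★ (s3); glue: ★ `tupleRel_id_comp_facObjIso_inv_of_compat` (moves), ★ `tupleRel_baseChange_fst`, ★ `tupleRel_trans`.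
[cite: MumfordFogartyKirwan1994, Ch. 7 §2 Definition 7.2 (p. 129), Definition 7.3 (p. 130) and §3 Proposition 7.3 steps (III)–(IV) (pp. 133–134)]
[cite: EGAIV3, Thm. 8.8.2 and Thm. 8.10.5] [cite: GortzWedhorn2020, §(10.13) and Thm. 10.57 ∕ Cor. 10.64 (pp. 261–267)] [cite: Kottwitz1992, §5 (pp. 389–391)] -/
theorem exists_stage_pelTuple_of_generic (hP : IsProper (pullback.snd P.hom (specOver A K).hom)) (hdual : dualAbelianSchemeExists)
    {O : Type*} [CommRing O] {m : ℕ} (bs : Module.Basis (Fin m) ℤ O) {g N : ℕ} [NeZero N] (hN : IsUnit ((N : ℕ) : K))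
    (A₁ : AbelianSchemeOver (P ⊗ specOver A K).left) (ρ₁ : RingAction O A₁) (D₁ : A₁.DualPair) (pol₁ : A₁.Polarization D₁)
    (φ₁ : A₁.LevelStructure g N) (hg : A₁.IsOfRelDim g) :
    ∃ (s : Idx (nonZeroDivisors A)) (𝒜 : AbelianSchemeOver (P ⊗ (baseDiagram (nonZeroDivisors A)).obj s).left) (ρ : RingAction O 𝒜)
      (D : 𝒜.DualPair) (pol : 𝒜.Polarization D) (φ : 𝒜.LevelStructure g N) (G : A₁.X.left ⟶ 𝒜.X.left) (Ĝ : D₁.hat.X.left ⟶ D.hat.X.left),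
      𝒜.IsOfRelDim g ∧ Flat (pullback.snd P.hom ((baseDiagram (nonZeroDivisors A)).obj s).hom) ∧
      (φ₁.IsBaseChangeVia φ (P ◁ (baseCone (nonZeroDivisors A) K).π.app s).left G ∧
        D₁.hat.IsBaseChangeVia D.hat (P ◁ (baseCone (nonZeroDivisors A) K).π.app s).left Ĝ ∧
        (∃ (wG : A₁.X.hom ≫ (P ◁ (baseCone (nonZeroDivisors A) K).π.app s).left = G ≫ 𝒜.X.hom)
            (wĜ : D₁.hat.X.hom ≫ (P ◁ (baseCone (nonZeroDivisors A) K).π.app s).left = Ĝ ≫ D.hat.X.hom),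
          Nonempty ((Scheme.Modules.pullback
            (pullback.map A₁.X.hom D₁.hat.X.hom 𝒜.X.hom D.hat.X.hom G Ĝ (P ◁ (baseCone (nonZeroDivisors A) K).π.app s).left wG wĜ)).obj
              D.P ≅ D₁.P)) ∧
        pol₁.lam.left ≫ Ĝ = G ≫ pol.lam.left ∧ ∀ a : O, (ρ₁.i a).left ≫ G = G ≫ (ρ.i a).left) := by
  classical
  -- (0) `2 ∈ A[1∕t]^×` below some stage `m₂`
  have h2K : IsUnit ((2 : ℕ) : K) := by rw [Nat.cast_ofNat]; exact isUnit_iff_ne_zero.mpr two_ne_zero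
  obtain ⟨m₂, hm₂⟩ := exists_idx_forall_isUnit_algebraMap_loc (S := nonZeroDivisors A) 2 h2K
  -- (1) spread the abelian scheme ★ (s1-A♭)
  obtain ⟨t₀, 𝒜₀, G₀, hbc₀, hg₀, hfl₀⟩ := exists_stage_of_generic_of_isOfRelDim_of_isProper_generic hP A₁ hg
  -- (2) restrict to `t ≤ t₀, m₂`
  obtain ⟨t, σ₀, ⟨τ₂⟩⟩ : ∃ (t : Idx (nonZeroDivisors A)) (_ : t ⟶ t₀), Nonempty (t ⟶ m₂) :=
    ⟨_, IsCofiltered.minToLeft t₀ m₂, ⟨IsCofiltered.minToRight t₀ m₂⟩⟩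
  have h2t : IsUnit (2 : loc (nonZeroDivisors A) t) := by
    have h := hm₂ t (leOfHom τ₂); rwa [map_natCast, Nat.cast_ofNat] at h
  haveI hflt : Flat (pullback.snd P.hom ((baseDiagram (nonZeroDivisors A)).obj t).hom) := flat_snd_baseDiagram_of_hom σ₀ hfl₀
  obtain ⟨Gt, hbct, -⟩ := exists_isBaseChangeVia_baseChange_of_over_hom (relLeg (nonZeroDivisors A) K P σ₀) 𝒜₀ hbc₀
  -- the stage family at `t` (generalised), its normalised dual pair
  obtain ⟨𝒜ₜ, Gt, hbct', hgt⟩ : ∃ (𝒜ₜ : AbelianSchemeOver (P ⊗ (baseDiagram (nonZeroDivisors A)).obj t).left)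
      (Gt : A₁.X.left ⟶ 𝒜ₜ.X.left), A₁.IsBaseChangeVia 𝒜ₜ (genOver (nonZeroDivisors A) K P t).hom Gt ∧ 𝒜ₜ.IsOfRelDim g :=
    ⟨𝒜₀.baseChange (stageOver (nonZeroDivisors A) P σ₀).hom, Gt, hbct, hg₀.baseChange _⟩
  clear hbct
  obtain ⟨Dₜ, hDₜ⟩ : ∃ Dₜ : 𝒜ₜ.DualPair,
      Nonempty ((Scheme.Modules.pullback (DualPair.unitHatSlice Dₜ)).obj Dₜ.P ≅ SheafOfModules.unit _) :=
    ⟨(dualPairOf hdual 𝒜ₜ).normalize, DualPair.nonempty_unitHatSlice_iso_normalize _⟩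
  -- (3) transport the E′-structures to `𝒜ₜ ×_{P_t} (P ⊗ Spec K)`: an isomorphism of tuples
  haveI : IsLocallyNoetherian (genOver (nonZeroDivisors A) K P t).left := ‹IsLocallyNoetherian (P ⊗ specOver A K).left›
  haveI : IsReduced (genOver (nonZeroDivisors A) K P t).left := ‹IsReduced (P ⊗ specOver A K).left›
  obtain ⟨e, he, ρg, φg, polg, -, hR₀⟩ := exists_transport_baseChange_tupleRel_id_of_isBaseChangeVia 𝒜ₜ Dₜ
    (genOver (nonZeroDivisors A) K P t).hom ρ₁ D₁ pol₁ φ₁ hbct' hDₜ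
  -- (4) ★ (s2-λ): spread `λ` (one stage `σ₁`) to a polarization (one more stage `ρ'`)
  obtain ⟨s₁, σ₁, lam₁, _, hfac₁, s, ρ', polS, hpolS⟩ :=
    exists_stage_polarization_of_generic_polarization_of_isUnit_two' K 𝒜ₜ Dₜ polg h2t hDₜ
  -- MOVE 1 along `σ₁`
  obtain ⟨ρg₁, φg₁, hR₁⟩ := exists_ringAction_levelStructure_tupleRel_id_comp_facObjIso_inv (relLeg (nonZeroDivisors A) K P σ₁) 𝒜ₜ Dₜ
    (fun a => ρ₁.i a) D₁ pol₁.lam φ₁ polg.lam φg ρg hR₀ ((Over.pullback (relLeg (nonZeroDivisors A) K P σ₁).left).map lam₁) hfac₁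
  clear hR₀
  -- MOVE 2 along `ρ'`
  have hlam₂ : (Over.pullback (relLeg (nonZeroDivisors A) K P ρ').left).map polS.lam ≫
      (facObjIso (relLeg (nonZeroDivisors A) K P ρ') (Dₜ.baseChange (stageOver (nonZeroDivisors A) P σ₁).hom).hat.X).hom =
      (facObjIso (relLeg (nonZeroDivisors A) K P ρ') (𝒜ₜ.baseChange (stageOver (nonZeroDivisors A) P σ₁).hom).X).hom ≫
        (Over.pullback (relLeg (nonZeroDivisors A) K P σ₁).left).map lam₁ := by
    rw [hpolS]
    exact facObjIso_hom_naturality (relLeg (nonZeroDivisors A) K P ρ') (𝒜ₜ.baseChange (stageOver (nonZeroDivisors A) P σ₁).hom)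
      (ℬ := (Dₜ.baseChange (stageOver (nonZeroDivisors A) P σ₁).hom).hat) lam₁
  obtain ⟨ρg₂, φg₂, hR₂⟩ := exists_ringAction_levelStructure_tupleRel_id_comp_facObjIso_inv (relLeg (nonZeroDivisors A) K P ρ')
    (𝒜ₜ.baseChange (stageOver (nonZeroDivisors A) P σ₁).hom) (Dₜ.baseChange (stageOver (nonZeroDivisors A) P σ₁).hom)
    (fun a => ρ₁.i a) D₁ pol₁.lam φ₁ _ φg₁ ρg₁ hR₁ ((Over.pullback (relLeg (nonZeroDivisors A) K P ρ').left).map polS.lam) hlam₂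
  clear hR₁ hlam₂
  -- (5)–(7): second half, at the stage `s`
  haveI : Flat (pullback.snd P.hom ((baseDiagram (nonZeroDivisors A)).obj s).hom) :=
    flat_snd_baseDiagram_of_hom ρ' (flat_snd_baseDiagram_of_hom σ₁ hflt)
  exact exists_stage_pelTuple_of_stage_polarization K bs hN
    ((𝒜ₜ.baseChange (stageOver (nonZeroDivisors A) P σ₁).hom).baseChange (stageOver (nonZeroDivisors A) P ρ').hom)
    ((hgt.baseChange _).baseChange _) _ polS ρg₂ φg₂ A₁ ρ₁ D₁ pol₁ φ₁ hR₂

end Head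

end AbelianSchemeOver

end Literature.AlgebraicGeometry.AbelianSchemes
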